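import Summits.QuantumFields.YangMills.Theses.ContractibleFibre
import Literature.MathematicalPhysics.QuantumLattice.LatticeGaugeDLR
import Literature.MathematicalPhysics.QuantumFieldTheory.WilsonTransferKernel

/-!
# Sketch — crux ideas for `FibreToTorus` (stmt-QuantumFields-16244), ideator 2, round 1

Crux-ideate seat `planner-cruxidea-stmt-QuantumFields-16244-2-0`.  Typed shapes of the FIRST LEMMAS and of the
re-cut statements named in the two idea cards `ergodic-selection` and `flux-sector-ledger`.  Nothing is proved
here (idea stage, no skeleton); every constant is an existing tree declaration.

Card `ergodic-selection`
* `MixingIsExtremal`                  — first lemma (pure ergodic theory, provable now): an `e₀`-mixing probability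
                                         measure is an extreme point of the `e₀`-invariant probability measures.
* `LongDirectionInvariance`           — what stub (T) must additionally record: the tube limit state is invariant
                                         under the two LONG translations `e₀, e₁` (tube symmetry; provable with (T)).
* `FibreTranslationInvariance` (NS)   — "no staggered phase": an `e₀`-mixing, `(e₀,e₁)`-invariant DLR state at weak
                                         coupling is `ℤ⁴`-invariant.  NEW small named statement; NECESSARY for the
                                         crux given (T)+(U_tr) (a fibre-staggered free state makes every symmetric
                                         torus limit point a non-clustering mixture).
* `TranslationInvariantUniqueness` (U_tr) — the WEAKENED replacement of stub `U` of line `uniqueness`: DLR states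
                                         that are `ℤ⁴`-translation invariant agree on `YMSpecies` (Israel's tangent
                                         cut: ⇔ the pressure functional has a unique tangent at `βΦ_W` on gauge-
                                         invariant local directions).  Torus limit points ARE `ℤ⁴`-invariant, so the
                                         glue `T → NS → U_tr → V → FibreToTorus` closes exactly as `uniqueness` does.
Card `flux-sector-ledger`
* `MixtureCovarianceFloor`            — first lemma (finite algebra of integrals, provable now): the connected
                                         correlation of a finite mixture of `τ`-invariant laws = mixture of the
                                         connected correlations + an `n`-INDEPENDENT variance floor of the means.
* `centreTwistedCyclicPartition`      — definition over `wilsonSliceKernel`: `Tr(C_z^{(i)} 𝕋^m)`, the cold-torus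
                                         partition function with one temporal 't Hooft twist `z ∈ Z(G)` across the
                                         spatial direction `i` (electric-flux currency).
* `FluxSuppression` (Φ)               — the confinement-strength input the torus passage (V) hides: on symmetric
                                         tori every central twist costs `O(e^{−cN})` in the partition function.
-/

noncomputable section

namespace Summit.QuantumFields.YangMills.Cruxes.FibreToTorus.IdeatorTwo

open scoped BigOperators Topology ENNReal
open Filter Set MeasureTheory
open Literature.MathematicalPhysics.QuantumLattice
open Literature.MathematicalPhysics.QuantumFieldTheory


/-! ## Card `ergodic-selection` -/

/-- `e₀`-mixing of a probability measure on lattice gauge configurations, on all bounded measurable functions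
(the form in which the tube limit state inherits the crux hypothesis: slab observables are arbitrary bounded
measurable functions, so the `M, L → ∞` limit state mixes in `e₀` on every bounded cylinder function and hence,
by approximation, on every bounded measurable function). -/
def IsTimeMixing {G : Type} [Group G] [MeasurableSpace G] (μ : Measure (LGConfig 4 G)) : Prop :=
  ∀ F H : LGConfig 4 G → ℝ, Measurable F → Measurable H → (∀ U, |F U| ≤ 1) → (∀ U, |H U| ≤ 1) →
    Tendsto (fun n : ℕ =>
      (∫ U, F U * H (configShift (-Pi.single 0 (n : ℤ)) U) ∂μ) -
        (∫ U, F U ∂μ) * ∫ U, H (configShift (-Pi.single 0 (n : ℤ)) U) ∂μ) atTop (𝓝 0)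

/-- **First lemma of `ergodic-selection` (provable now; Walters Thm 1.6 / Georgii Thm 14.15 shape).**
An `e₀`-mixing probability measure is an EXTREME point of the convex set of `e₀`-invariant probability measures:
if `μ = t ν₁ + (1−t) ν₂` with `ν₁, ν₂` invariant under the unit time shift and `0 < t < 1`, then `ν₁ = ν₂`.
(Mixing ⇒ ergodic; an invariant `ν₁ ≪ μ` has an invariant density, which ergodicity forces to be constant.)
In particular the tube limit state is extreme among the `e₀`-invariant (a fortiori among the translation-
invariant) DLR states of the Wilson specification: a PURE phase, never a mixture. -/
def MixingIsExtremal : Prop :=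
  ∀ (G : Type) [Group G] [MeasurableSpace G] (μ ν₁ ν₂ : Measure (LGConfig 4 G)),
    IsProbabilityMeasure μ → IsProbabilityMeasure ν₁ → IsProbabilityMeasure ν₂ →
    IsTimeMixing μ →
    ν₁.map (configShift (Pi.single 0 1)) = ν₁ → ν₂.map (configShift (Pi.single 0 1)) = ν₂ →
    ∀ t : ℝ, 0 < t → t < 1 → μ = ENNReal.ofReal t • ν₁ + ENNReal.ofReal (1 - t) • ν₂ → ν₁ = ν₂

/-- **What (T) must record in addition** (provable together with (T): the free tube is invariant under both long
translations, and so is every `L, M → ∞` limit point): the clustering DLR state delivered by the tube family is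
invariant under `e₀` and `e₁`. -/
def LongDirectionInvariance {G : Type} [Group G] [MeasurableSpace G] (μ : Measure (LGConfig 4 G)) : Prop :=
  μ.map (configShift (Pi.single 0 1)) = μ ∧ μ.map (configShift (Pi.single 1 1)) = μ

/-- **(NS) No staggered phase at weak coupling** — the one GEOMETRIC input the selection argument cannot supply:
for `β ≥ β_s`, a DLR state of the Wilson specification that is invariant under the two long translations and
`e₀`-mixing is invariant under ALL lattice translations (the fibre translations `e₂, e₃` included).  Necessary for
the crux given (T) and (U_tr): if the free-tube state `μ` had `τ_{e₂} μ ≠ μ`, every symmetric-torus limit point —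
being `ℤ⁴`-invariant — would be the non-trivial mixture of the fibre translates of `μ` (by U_tr applied to the
Cesàro average) and could not cluster. -/
def FibreTranslationInvariance : Prop :=
  ∀ (G : Type) [Group G] [TopologicalSpace G] [IsTopologicalGroup G] [CompactSpace G] [MeasurableSpace G]
    [BorelSpace G], IsCompactSimpleLieGroup G → ∀ r : LatticeRep G, ∃ βs : ℝ, ∀ β : ℝ, βs ≤ β →
    ∀ μ : Measure (LGConfig 4 G), μ ∈ ymGibbsMeasures (d := 4) r.ρ β →
      LongDirectionInvariance μ → IsTimeMixing μ → IsZdTranslationInvariant μ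

/-- **(U_tr) Translation-invariant uniqueness on the gauge-invariant algebra** — the weakened replacement of stub
`U` (`stub_gaugeInvariantUniqueness`) of line `uniqueness`: only `ℤ⁴`-INVARIANT DLR states are compared.  By
Israel's theorem (Convexity in the Theory of Lattice Gases, Cor. II.1.3 with `H` = the gauge group, Thm III.2.1,
Lemma III.1.1) this is exactly: the pressure functional `P` on the Banach space of translation- and gauge-invariant
interactions has a UNIQUE tangent at `β Φ_Wilson` — a property of one convex function, with no boundary condition,
no state and no rate in it. -/
def TranslationInvariantUniqueness : Prop :=
  ∀ (G : Type) [Group G] [TopologicalSpace G] [IsTopologicalGroup G] [CompactSpace G] [MeasurableSpace G]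
    [BorelSpace G], IsCompactSimpleLieGroup G → ∀ r : LatticeRep G, ∃ βu : ℝ, ∀ β : ℝ, βu ≤ β →
    ∀ μ ν : Measure (LGConfig 4 G), μ ∈ ymGibbsMeasures (d := 4) r.ρ β → ν ∈ ymGibbsMeasures (d := 4) r.ρ β →
      IsZdTranslationInvariant μ → IsZdTranslationInvariant ν →
      ∀ A : YMSpecies G, ∫ U, A.F U ∂μ = ∫ U, A.F U ∂ν

/-- The two-parameter pressure the tangent cut lives on (definition request D1 of the card, minimal form): the
free energy density of the Wilson action perturbed by `λ Σ_x A(τ_x U)` for ONE local gauge-invariant `A`, along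
tori.  `U_tr` ⇔ `∀ A, λ ↦ p(β, λ; A)` is differentiable at `λ = 0` for `β ≥ β_u`.  (Shape only: the perturbed torus
partition function is written with `torusLift`; existence of the limit is the same subadditivity as
`exists_hasFreeEnergyDensity`.) -/
def perturbedTorusLogPartition {G : Type} [Group G] [TopologicalSpace G] [IsTopologicalGroup G] [CompactSpace G]
    [MeasurableSpace G] [BorelSpace G] {N : ℕ} (ρ : G →* Matrix (Fin N) (Fin N) ℂ) (β lam : ℝ)
    (A : LGConfig 4 G → ℝ) (L : ℕ) [NeZero L] : ℝ :=
  Real.log (∫ U, Real.exp (lam * ∑ x : Site 4 L, A (configShift (-(fun i => ((x i).val : ℤ))) (torusLift L U)))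
    ∂(wilsonMeasure (d := 4) (L := L) ρ β)) + torusLogPartition 4 ρ β L

/-! ## Card `flux-sector-ledger` -/

/-- **First lemma of `flux-sector-ledger` (provable now; finite algebra of Bochner integrals).**  For a finite
mixture `P = Σ_e w_e P_e` of probability laws each invariant under a map `τ`, and bounded measurable `A, B`:
`Cov_P(A, B∘τ) = Σ_e w_e Cov_{P_e}(A, B∘τ) + ½ Σ_{e,e'} w_e w_{e'} (P_e A − P_{e'} A)(P_e B − P_{e'} B)` — the
second term does not see `τ` (so not the time separation): a VARIANCE FLOOR.  Applied to the symmetric-torus Wilson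
measure written as the mixture of its 't Hooft electric-flux sector laws (centre superselection: local
gauge-invariant observables and the transfer matrix commute with the centre transformations), the crux's
`S`-uniform conclusion forces the floor below `C e^{−m S}`. -/
def MixtureCovarianceFloor : Prop :=
  ∀ (G : Type) [Group G] [MeasurableSpace G] (k : ℕ) (w : Fin k → ℝ) (P : Fin k → Measure (LGConfig 4 G))
    (τ : LGConfig 4 G → LGConfig 4 G) (A B : LGConfig 4 G → ℝ),
    (∀ e, IsProbabilityMeasure (P e)) → (∀ e, 0 ≤ w e) → ∑ e, w e = 1 → Measurable τ →
    (∀ e, (P e).map τ = P e) → Measurable A → Measurable B → (∀ U, |A U| ≤ 1) → (∀ U, |B U| ≤ 1) →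
    (∫ U, A U * B (τ U) ∂(∑ e, ENNReal.ofReal (w e) • P e)) -
        (∫ U, A U ∂(∑ e, ENNReal.ofReal (w e) • P e)) * (∫ U, B (τ U) ∂(∑ e, ENNReal.ofReal (w e) • P e)) =
      (∑ e, w e * ((∫ U, A U * B (τ U) ∂P e) - (∫ U, A U ∂P e) * ∫ U, B (τ U) ∂P e)) +
        (1 / 2) * ∑ e, ∑ e', w e * w e' *
          (((∫ U, A U ∂P e) - ∫ U, A U ∂P e') * ((∫ U, B U ∂P e) - ∫ U, B U ∂P e'))

/-- **Electric-flux currency**: the cold-torus partition function `m × N³` with ONE temporal 't Hooft twist by a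
central element `z` across the spatial direction `i` — the cyclic integral of `wilsonSliceKernel`s in which the
slice entering the kernel at time `0` has its links `(x⃗, i)` with `x_i = 0` multiplied by `z`
(`= Tr(C_z^{(i)} 𝕋^m)`, `C_z^{(i)}` the centre transformation; for `z = 1` it is `cyclicPartition ρ β N m`).
Its ratio to `cyclicPartition` is `e^{−F}` for 't Hooft's twist free energy; the `Ẑ(G)`-Fourier transform in `z`
gives the electric-flux sector weights `w_e`. -/
def centreTwistedCyclicPartition {G : Type} [Group G] [TopologicalSpace G] [IsTopologicalGroup G]
    [CompactSpace G] [MeasurableSpace G] [BorelSpace G] {n : ℕ} (ρ : G →* Matrix (Fin n) (Fin n) ℂ)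
    (β : ℝ) (N m : ℕ) [NeZero N] [NeZero m] (i : Fin 3) (z : G) : ℝ :=
  ∫ V : ZMod m → GaugeConfig 3 N G,
    ∏ t : ZMod m, wilsonSliceKernel ρ β (V t)
      (if t + 1 = 0 then (fun e => if e.2 = i ∧ e.1 i = 0 then z * V (t + 1) e else V (t + 1) e) else V (t + 1))
    ∂(Measure.pi fun _ : ZMod m => Measure.pi fun _ : Edge 3 N => haarProbability G)

/-- **(Φ) Flux suppression on symmetric tori at weak coupling** (the confinement-strength input hidden in stub V):
for `β ≥ β_f` there are `C, c > 0` and `N₁` such that on every symmetric cold torus `N × N³`, `N ≥ N₁`, every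
temporal twist by a central `z` changes the partition function by a factor `1 ± C e^{−cN}` — 't Hooft's "twists
cost nothing" (Kovács–Tomboulis `Z₋/Z₊ → 1`), equivalently all non-zero electric-flux sector weights are
`O(e^{−cN})`.  Vacuous for centre-free `G`. -/
def FluxSuppression : Prop :=
  ∀ (G : Type) [Group G] [TopologicalSpace G] [IsTopologicalGroup G] [CompactSpace G] [MeasurableSpace G]
    [BorelSpace G], IsCompactSimpleLieGroup G → ∀ r : LatticeRep G, ∃ βf : ℝ, ∀ β : ℝ, βf ≤ β →
    ∃ C c : ℝ, 0 < c ∧ ∃ N₁ : ℕ, ∀ (N : ℕ) [NeZero N], N₁ ≤ N → ∀ (i : Fin 3) (z : G), z ∈ Subgroup.center G →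
      |centreTwistedCyclicPartition r.ρ β N N i z / cyclicPartition r.ρ β N N - 1| ≤ C * Real.exp (-(c * N))

end Summit.QuantumFields.YangMills.Cruxes.FibreToTorus.IdeatorTwo

end
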